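import Summits.NavierStokesRegularity.NavierStokesRegularity.Theorems.ExtremiserTransiencePinnedDepletionDefs
import Summits.NavierStokesRegularity.NavierStokesRegularity.Theorems.ExtremiserTransiencePinnedDepletionSandwich
import Summits.NavierStokesRegularity.NavierStokesRegularity.Theorems.ExtremiserTransienceNearExtremalTransiencePerFlowStubEfficiencyContinuous
import Summits.NavierStokesRegularity.NavierStokesRegularity.Theorems.ExtremiserTransienceNearExtremalTransienceDSSPerFlowAnalytic
import HarnessLib

/-!
# Crux `NearExtremalTransiencePerFlow` (stmt-NavierStokesRegularity-26567), LINES g13-α `budget_cut` / g13-β `relay`: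
# EARLY WINDOWS ARE UNIFORMLY DEPLETED — the pinned statements reduce to LATE windows

Theorems file (`--supports stmt-NavierStokesRegularity-26567`, helper; prover seat ns-net-p1 g17).  Branch (B) of the K♭ plan of
`Lines/budget_cut.lean` (card §K♭: «non-depleted times `tₙ' → t* < T`: continuity of `q` at a regular time and the landed strict
inequality `slice_lt_sharp` — absurd») done once and for all, in the kernel, for every pinned statement of the two g13 lines
(texts of record `…Theorems.ExtremiserTransiencePinnedDepletionDefs`):

* `exists_uniform_depletion_on_compact` — in a violator, on every compact interval of POSITIVE times `[s₁, s₂] ⊂ (0, T)` there is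
  ONE margin `ε₀ > 0` such that every `t' ∈ [s₁, s₂]` is `ε₀`-depleted (`|J(t')| ≤ (κ⋆ − ε₀)·M'·√Z·√P` for every height bound `M'`).
  Proof: a minimal coefficient `k₀` (`exists_isMinimalCoeff`) is continuous on `(0,T)` (Z3 `stub_efficiencyContinuous`, p661994) and
  strictly below `κ⋆` at every positive time (`DepletionLadder.minimalCoeff_lt_sharp_of_pos`: analyticity + non-attainment); take its
  maximum on the compact interval.
* `exists_early_fraction` — hence for every `t₁ < T` there is `ε > 0` such that every PINNED window `I = [t, t + τ₁ν/M²]`,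
  `M = C√ν/√(T−t)`, starting at `t ≤ t₁` has `|DEPLETED_ε ∩ I| ≥ ε|I|`: the pin makes `|I| = a(T−t)`, `a = τ₁/C²`, so the right half
  of every early window lies in the fixed compact `[(a/2)(T−t₁), t₁ + a(T−t₁)] ⊂ (0,T)`.
* `PinnedDepletedFraction.of_late`, `SmallBudgetDepletion.of_late`, `CrowdDepletion.of_late` — the junction `C′`, K♭ and C♭ each
  follow from their LATE versions, in which the prover may first choose any `t₁ < T` (per violator and window package) and treat
  only windows with `t₁ ≤ t`.  So every pinned statement of the g13 lines is a statement about windows arbitrarily close to the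
  blow-up time; branch (A) of the K♭ plan (times `→ T`: zoom + finitely-many-tall-cells + non-attainment in the Type-I ancient limit)
  is all that remains of K♭.

HONEST FRAMING: statements about hypothetical Type-I singular flows violating the crux; K♭, C♭, the junction, ⟨26567⟩ and NS
regularity are OPEN; nothing about Navier–Stokes regularity or blow-up is proved; no summit is proved by a line. [folklore]
-/

noncomputable section

open scoped Topology InnerProductSpace RealInnerProductSpace ENNReal ContDiff
open MeasureTheory Filter Set Metric
open Literature.Analysis.FluidPDE
open Summit.NavierStokesRegularity.NavierStokesRegularity.Theorems
open Summit.NavierStokesRegularity.NavierStokesRegularity.Theorems.DepletionLadder.KStar.HalfSpace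
open Summit.NavierStokesRegularity.NavierStokesRegularity.Theorems.NearExtremalTransiencePerFlow.ZoneTransversality

namespace Summit.NavierStokesRegularity.NavierStokesRegularity.Theorems.NearExtremalTransiencePerFlow.PinnedDepletion

-- the summit's namespace repeats the problem name by convention (D-0017)
set_option linter.dupNamespace false

/-! ### §1 Uniform depletion on compact intervals of positive times -/

/-- **Uniform depletion away from `0` and `T`.**  In a violator flow, on every compact interval `[s₁, s₂] ⊂ (0, T)` there is
`ε₀ > 0` such that every `t' ∈ [s₁, s₂]` is `ε₀`-DEPLETED: `|J(t')| ≤ (κ⋆ − ε₀)·M'·√Z(t')·√P(t')` for every height bound `M'`.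
(Z3 continuity of the minimal coefficient + strict sharpness at positive times + compactness.) [folklore] -/
theorem exists_uniform_depletion_on_compact {C ν T : ℝ} {u : ℝ → EuclideanSpace ℝ (Fin 3) → EuclideanSpace ℝ (Fin 3)}
    {p : ℝ → EuclideanSpace ℝ (Fin 3) → ℝ} (hV : IsViolator C ν T u p) {s₁ s₂ : ℝ} (hs₁ : 0 < s₁) (hs₁₂ : s₁ ≤ s₂)
    (hs₂ : s₂ < T) :
    ∃ ε₀ : ℝ, 0 < ε₀ ∧ ∀ t' ∈ Set.Icc s₁ s₂, ∀ M' : ℝ, (∀ x, ‖u t' x‖ ≤ M') →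
      |∫ x, ⟪curl (u t') x, fderiv ℝ (u t') x (curl (u t') x)⟫_ℝ| ≤
        (kStar - ε₀) * M' * Real.sqrt (∫ x, ‖curl (u t') x‖ ^ 2) *
          Real.sqrt (∫ x, frobeniusNormSq (fderiv ℝ (curl (u t')) x)) := by
  have hV' := hV
  obtain ⟨hC, hν, hT, hsol, hLH, hdec, hrate, hsing, hno⟩ := hV
  obtain ⟨k₀, hk₀⟩ := exists_isMinimalCoeff hν hT hsol hLH hdec
  have hcont : ContinuousOn k₀ (Set.Ioo 0 T) := stub_efficiencyContinuous C ν T u p hV' k₀ hk₀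
  obtain ⟨hkm, hk01, hcl, hmin⟩ := hk₀
  have hsub : Set.Icc s₁ s₂ ⊆ Set.Ioo 0 T := fun t ht => ⟨hs₁.trans_le ht.1, lt_of_le_of_lt ht.2 hs₂⟩
  have hcpt : IsCompact (Set.Icc s₁ s₂) := isCompact_Icc
  have hne : (Set.Icc s₁ s₂).Nonempty := ⟨s₁, le_rfl, hs₁₂⟩
  obtain ⟨tm, htm, hmax⟩ := hcpt.exists_isMaxOn hne (hcont.mono hsub)
  have hlt : k₀ tm < kStar := by
    unfold kStar udcSet
    exact DepletionLadder.minimalCoeff_lt_sharp_of_pos hν hT hsol hLH hdec hmin tm (hsub htm)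
  refine ⟨kStar - k₀ tm, sub_pos.2 hlt, ?_⟩
  intro t' ht' M' hM'
  have ht'T : t' ∈ Set.Ico 0 T := ⟨(hsub ht').1.le, (hsub ht').2⟩
  have hM'0 : 0 ≤ M' := (norm_nonneg _).trans (hM' 0)
  have hfac : 0 ≤ M' * Real.sqrt (∫ x, ‖curl (u t') x‖ ^ 2) *
      Real.sqrt (∫ x, frobeniusNormSq (fderiv ℝ (curl (u t')) x)) := by positivity
  have hk : k₀ t' ≤ kStar - (kStar - k₀ tm) := by
    have := hmax ht'
    simp only [Set.mem_setOf_eq] at this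
    linarith
  calc |∫ x, ⟪curl (u t') x, fderiv ℝ (u t') x (curl (u t') x)⟫_ℝ|
      ≤ k₀ t' * M' * Real.sqrt (∫ x, ‖curl (u t') x‖ ^ 2) *
          Real.sqrt (∫ x, frobeniusNormSq (fderiv ℝ (curl (u t')) x)) := hcl t' ht'T M' hM'
    _ = k₀ t' * (M' * Real.sqrt (∫ x, ‖curl (u t') x‖ ^ 2) *
          Real.sqrt (∫ x, frobeniusNormSq (fderiv ℝ (curl (u t')) x))) := by ring
    _ ≤ (kStar - (kStar - k₀ tm)) * (M' * Real.sqrt (∫ x, ‖curl (u t') x‖ ^ 2) *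
          Real.sqrt (∫ x, frobeniusNormSq (fderiv ℝ (curl (u t')) x))) := mul_le_mul_of_nonneg_right hk hfac
    _ = (kStar - (kStar - k₀ tm)) * M' * Real.sqrt (∫ x, ‖curl (u t') x‖ ^ 2) *
          Real.sqrt (∫ x, frobeniusNormSq (fderiv ℝ (curl (u t')) x)) := by ring

/-! ### §2 Early pinned windows carry a depleted fraction -/

/-- **Early pinned windows are depleted.**  In a violator flow, for every `τ₁ > 0` and every `t₁ < T` there is `ε > 0` such that
every PINNED window `I = [t, t + τ₁ν/M²]`, `M = C√ν/√(T−t)`, `I ⊂ [0,T)`, starting at `t ≤ t₁` has `ε`-depleted times of measure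
`≥ ε|I|`.  The pin gives `|I| = a(T−t)` with `a = τ₁/C²`; the right half of every such window lies in the compact
`[(a/2)(T−t₁), t₁ + a(T−t₁)] ⊂ (0,T)`, where `exists_uniform_depletion_on_compact` applies. [folklore] -/
theorem exists_early_fraction {C ν T : ℝ} {u : ℝ → EuclideanSpace ℝ (Fin 3) → EuclideanSpace ℝ (Fin 3)}
    {p : ℝ → EuclideanSpace ℝ (Fin 3) → ℝ} (hV : IsViolator C ν T u p) {τ₁ : ℝ} (hτ₁ : 0 < τ₁) {t₁ : ℝ} (ht₁ : t₁ < T) :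
    ∃ ε : ℝ, 0 < ε ∧ ∀ (t M : ℝ), 0 ≤ t → 0 < M → t + τ₁ * ν / M ^ 2 < T → M = C * Real.sqrt ν / Real.sqrt (T - t) →
      t ≤ t₁ →
      ENNReal.ofReal (ε * (τ₁ * ν / M ^ 2)) ≤
        volume ({t' : ℝ | ∀ M' : ℝ, (∀ x, ‖u t' x‖ ≤ M') →
            |∫ x, ⟪curl (u t') x, fderiv ℝ (u t') x (curl (u t') x)⟫_ℝ| ≤
              (kStar - ε) * M' * Real.sqrt (∫ x, ‖curl (u t') x‖ ^ 2) *
                Real.sqrt (∫ x, frobeniusNormSq (fderiv ℝ (curl (u t')) x))} ∩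
          Set.Icc t (t + τ₁ * ν / M ^ 2)) := by
  have hV' := hV
  obtain ⟨hC, hν, hT, hsol, hLH, hdec, hrate, hsing, hno⟩ := hV
  have hC2 : 0 < C ^ 2 := by positivity
  -- the relative window length `a = τ₁/C²`, and the window identity under the pin
  set a : ℝ := τ₁ / C ^ 2 with hadef
  have ha : 0 < a := div_pos hτ₁ hC2
  have hwin : ∀ t M : ℝ, t < T → M = C * Real.sqrt ν / Real.sqrt (T - t) → τ₁ * ν / M ^ 2 = a * (T - t) := by
    intro t M htT hpin
    have hTt : 0 < T - t := sub_pos.2 htT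
    have hM2 : M ^ 2 = C ^ 2 * ν / (T - t) := by
      rw [hpin, div_pow, mul_pow, Real.sq_sqrt hν.le, Real.sq_sqrt hTt.le]
    rw [hM2, hadef]
    field_simp
  have htltT : ∀ t M : ℝ, 0 < M → t + τ₁ * ν / M ^ 2 < T → t < T := by
    intro t M hM htT
    have hL : 0 < τ₁ * ν / M ^ 2 := by positivity
    linarith
  -- vacuous cases: no early window at all
  by_cases ht₁0 : t₁ < 0
  · refine ⟨1, one_pos, fun t M ht hM htT hpin htt₁ => ?_⟩
    exact absurd (ht.trans htt₁) (not_le.2 ht₁0)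
  push Not at ht₁0
  by_cases ha1 : 1 ≤ a
  · refine ⟨1, one_pos, fun t M ht hM htT hpin htt₁ => ?_⟩
    exfalso
    have htT' : t < T := htltT t M hM htT
    have hTt : 0 < T - t := sub_pos.2 htT'
    have h := hwin t M htT' hpin
    have : T - t ≤ a * (T - t) := by nlinarith
    linarith
  push Not at ha1
  -- the compact interval of positive times containing the right half of every early window
  have hTt₁ : 0 < T - t₁ := sub_pos.2 ht₁
  have hs₁ : 0 < a / 2 * (T - t₁) := by positivity
  have hs₂ : t₁ + a * (T - t₁) < T := by nlinarith
  have hs₁₂ : a / 2 * (T - t₁) ≤ t₁ + a * (T - t₁) := by nlinarith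
  obtain ⟨ε₀, hε₀, hdep⟩ := exists_uniform_depletion_on_compact hV' hs₁ hs₁₂ hs₂
  refine ⟨min ε₀ (1 / 2), lt_min hε₀ (by norm_num), fun t M ht hM htT hpin htt₁ => ?_⟩
  have htT' : t < T := htltT t M hM htT
  have hTt : 0 < T - t := sub_pos.2 htT'
  have hLeq : τ₁ * ν / M ^ 2 = a * (T - t) := hwin t M htT' hpin
  have hL : 0 < τ₁ * ν / M ^ 2 := by positivity
  set L : ℝ := τ₁ * ν / M ^ 2 with hLdef
  -- the right half of the window
  have hRsub : Set.Icc (t + L / 2) (t + L) ⊆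
      {t' : ℝ | ∀ M' : ℝ, (∀ x, ‖u t' x‖ ≤ M') →
          |∫ x, ⟪curl (u t') x, fderiv ℝ (u t') x (curl (u t') x)⟫_ℝ| ≤
            (kStar - min ε₀ (1 / 2)) * M' * Real.sqrt (∫ x, ‖curl (u t') x‖ ^ 2) *
              Real.sqrt (∫ x, frobeniusNormSq (fderiv ℝ (curl (u t')) x))} ∩
        Set.Icc t (t + L) := by
    intro t' ht'
    have ht'1 : t + L / 2 ≤ t' := ht'.1
    have ht'2 : t' ≤ t + L := ht'.2
    refine ⟨?_, ⟨by linarith, ht'2⟩⟩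
    have hlo : a / 2 * (T - t₁) ≤ t' := by nlinarith
    have hhi : t' ≤ t₁ + a * (T - t₁) := by nlinarith
    exact depleted_mono u (min_le_left ε₀ (1 / 2)) (hdep t' ⟨hlo, hhi⟩)
  have hvolR : volume (Set.Icc (t + L / 2) (t + L)) = ENNReal.ofReal (L / 2) := by
    rw [Real.volume_Icc]
    ring_nf
  calc ENNReal.ofReal (min ε₀ (1 / 2) * L) ≤ ENNReal.ofReal (L / 2) := by
        refine ENNReal.ofReal_le_ofReal ?_
        nlinarith [min_le_right ε₀ (1 / 2), hL.le]
    _ = volume (Set.Icc (t + L / 2) (t + L)) := hvolR.symm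
    _ ≤ _ := measure_mono hRsub

/-! ### §3 The pinned statements reduce to LATE windows -/

/-- **The junction reduces to late windows.**  If every violator has, for every window package, an onset `t₁ < T` and `ε > 0` such
that every PINNED admissible window starting at `t ≥ t₁` carries `ε`-depleted times of measure `≥ ε|I|`, then `PinnedDepletedFraction`
(early windows by `exists_early_fraction`, monotonicity in `ε`). [folklore] -/
theorem PinnedDepletedFraction.of_late
    (h : ∀ (C ν T : ℝ) (u : ℝ → EuclideanSpace ℝ (Fin 3) → EuclideanSpace ℝ (Fin 3)) (p : ℝ → EuclideanSpace ℝ (Fin 3) → ℝ),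
      IsViolator C ν T u p →
      ∀ (Θ G H τ₁ : ℝ), 0 < Θ → 0 < G → 0 < H → 0 < τ₁ → ∃ t₁ : ℝ, t₁ < T ∧ ∃ ε : ℝ, 0 < ε ∧
      ∀ (t M : ℝ), 0 ≤ t → 0 < M → t + τ₁ * ν / M ^ 2 < T → M = C * Real.sqrt ν / Real.sqrt (T - t) → t₁ ≤ t →
        (∀ x, ‖u t x‖ ≤ M) →
        (∫ x, ‖curl (u t) x‖ ^ 2) ≤ Θ * (ν / M) ^ 2 * (∫ x, frobeniusNormSq (fderiv ℝ (curl (u t)) x)) →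
        (∀ x, ‖fderiv ℝ (u t) x‖ ≤ G * M ^ 2 / ν) →
        (∀ t' ∈ Set.Icc t (t + τ₁ * ν / M ^ 2), ∀ x, ‖u t' x‖ ≤ H * M) →
        ENNReal.ofReal (ε * (τ₁ * ν / M ^ 2)) ≤
          volume ({t' : ℝ | ∀ M' : ℝ, (∀ x, ‖u t' x‖ ≤ M') →
              |∫ x, ⟪curl (u t') x, fderiv ℝ (u t') x (curl (u t') x)⟫_ℝ| ≤
                (kStar - ε) * M' * Real.sqrt (∫ x, ‖curl (u t') x‖ ^ 2) *
                  Real.sqrt (∫ x, frobeniusNormSq (fderiv ℝ (curl (u t')) x))} ∩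
            Set.Icc t (t + τ₁ * ν / M ^ 2))) :
    PinnedDepletedFraction := by
  intro C ν T u p hV Θ G H τ₁ hΘ hG hH hτ₁
  have hν : 0 < ν := hV.2.1
  obtain ⟨t₁, ht₁, ε₁, hε₁, hlate⟩ := h C ν T u p hV Θ G H τ₁ hΘ hG hH hτ₁
  obtain ⟨ε₂, hε₂, hearly⟩ := exists_early_fraction hV hτ₁ ht₁
  refine ⟨min ε₁ ε₂, lt_min hε₁ hε₂, ?_⟩
  intro t M ht hM htT hpin hMb hlock hgrad hheights
  have hL : 0 ≤ τ₁ * ν / M ^ 2 := by positivity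
  rcases le_total t₁ t with h1 | h2
  · exact fraction_mono u (Set.Icc t (t + τ₁ * ν / M ^ 2)) (min_le_left _ _) hL
      (hlate t M ht hM htT hpin h1 hMb hlock hgrad hheights)
  · exact fraction_mono u (Set.Icc t (t + τ₁ * ν / M ^ 2)) (min_le_right _ _) hL (hearly t M ht hM htT hpin h2)

/-- **K♭ reduces to late windows** (branch (B) of the K♭ plan, done): `SmallBudgetDepletion` follows from its late version
(onset `t₁ < T` chosen per violator, package and budget `N₀`). [folklore] -/
theorem SmallBudgetDepletion.of_late
    (h : ∀ (C ν T : ℝ) (u : ℝ → EuclideanSpace ℝ (Fin 3) → EuclideanSpace ℝ (Fin 3)) (p : ℝ → EuclideanSpace ℝ (Fin 3) → ℝ),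
      IsViolator C ν T u p →
      ∀ (Θ G H τ₁ N₀ : ℝ), 0 < Θ → 0 < G → 0 < H → 0 < τ₁ → 0 < N₀ → ∃ t₁ : ℝ, t₁ < T ∧ ∃ ε : ℝ, 0 < ε ∧
      ∀ (t M : ℝ), 0 ≤ t → 0 < M → t + τ₁ * ν / M ^ 2 < T → M = C * Real.sqrt ν / Real.sqrt (T - t) → t₁ ≤ t →
        (∀ x, ‖u t x‖ ≤ M) →
        (∫ x, ‖curl (u t) x‖ ^ 2) ≤ Θ * (ν / M) ^ 2 * (∫ x, frobeniusNormSq (fderiv ℝ (curl (u t)) x)) →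
        (∀ x, ‖fderiv ℝ (u t) x‖ ≤ G * M ^ 2 / ν) →
        (∀ t' ∈ Set.Icc t (t + τ₁ * ν / M ^ 2), ∀ x, ‖u t' x‖ ≤ H * M) →
        (∫ x, ‖curl (u t) x‖ ^ 2) ≤ N₀ * (M * ν) →
        ENNReal.ofReal (ε * (τ₁ * ν / M ^ 2)) ≤
          volume ({t' : ℝ | ∀ M' : ℝ, (∀ x, ‖u t' x‖ ≤ M') →
              |∫ x, ⟪curl (u t') x, fderiv ℝ (u t') x (curl (u t') x)⟫_ℝ| ≤
                (kStar - ε) * M' * Real.sqrt (∫ x, ‖curl (u t') x‖ ^ 2) *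
                  Real.sqrt (∫ x, frobeniusNormSq (fderiv ℝ (curl (u t')) x))} ∩
            Set.Icc t (t + τ₁ * ν / M ^ 2))) :
    SmallBudgetDepletion := by
  intro C ν T u p hV Θ G H τ₁ N₀ hΘ hG hH hτ₁ hN₀
  have hν : 0 < ν := hV.2.1
  obtain ⟨t₁, ht₁, ε₁, hε₁, hlate⟩ := h C ν T u p hV Θ G H τ₁ N₀ hΘ hG hH hτ₁ hN₀
  obtain ⟨ε₂, hε₂, hearly⟩ := exists_early_fraction hV hτ₁ ht₁
  refine ⟨min ε₁ ε₂, lt_min hε₁ hε₂, ?_⟩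
  intro t M ht hM htT hpin hMb hlock hgrad hheights hbudget
  have hL : 0 ≤ τ₁ * ν / M ^ 2 := by positivity
  rcases le_total t₁ t with h1 | h2
  · exact fraction_mono u (Set.Icc t (t + τ₁ * ν / M ^ 2)) (min_le_left _ _) hL
      (hlate t M ht hM htT hpin h1 hMb hlock hgrad hheights hbudget)
  · exact fraction_mono u (Set.Icc t (t + τ₁ * ν / M ^ 2)) (min_le_right _ _) hL (hearly t M ht hM htT hpin h2)

/-- **C♭ reduces to late windows**: `CrowdDepletion` follows from its late version (onset `t₁ < T`, then `N₀, ε`, chosen per violator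
and package). [folklore] -/
theorem CrowdDepletion.of_late
    (h : ∀ (C ν T : ℝ) (u : ℝ → EuclideanSpace ℝ (Fin 3) → EuclideanSpace ℝ (Fin 3)) (p : ℝ → EuclideanSpace ℝ (Fin 3) → ℝ),
      IsViolator C ν T u p →
      ∀ (Θ G H τ₁ : ℝ), 0 < Θ → 0 < G → 0 < H → 0 < τ₁ → ∃ t₁ : ℝ, t₁ < T ∧ ∃ N₀ ε : ℝ, 0 < N₀ ∧ 0 < ε ∧
      ∀ (t M : ℝ), 0 ≤ t → 0 < M → t + τ₁ * ν / M ^ 2 < T → M = C * Real.sqrt ν / Real.sqrt (T - t) → t₁ ≤ t →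
        (∀ x, ‖u t x‖ ≤ M) →
        (∫ x, ‖curl (u t) x‖ ^ 2) ≤ Θ * (ν / M) ^ 2 * (∫ x, frobeniusNormSq (fderiv ℝ (curl (u t)) x)) →
        (∀ x, ‖fderiv ℝ (u t) x‖ ≤ G * M ^ 2 / ν) →
        (∀ t' ∈ Set.Icc t (t + τ₁ * ν / M ^ 2), ∀ x, ‖u t' x‖ ≤ H * M) →
        N₀ * (M * ν) ≤ (∫ x, ‖curl (u t) x‖ ^ 2) →
        ENNReal.ofReal (ε * (τ₁ * ν / M ^ 2)) ≤
          volume ({t' : ℝ | ∀ M' : ℝ, (∀ x, ‖u t' x‖ ≤ M') →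
              |∫ x, ⟪curl (u t') x, fderiv ℝ (u t') x (curl (u t') x)⟫_ℝ| ≤
                (kStar - ε) * M' * Real.sqrt (∫ x, ‖curl (u t') x‖ ^ 2) *
                  Real.sqrt (∫ x, frobeniusNormSq (fderiv ℝ (curl (u t')) x))} ∩
            Set.Icc t (t + τ₁ * ν / M ^ 2))) :
    CrowdDepletion := by
  intro C ν T u p hV Θ G H τ₁ hΘ hG hH hτ₁
  have hν : 0 < ν := hV.2.1
  obtain ⟨t₁, ht₁, N₀, ε₁, hN₀, hε₁, hlate⟩ := h C ν T u p hV Θ G H τ₁ hΘ hG hH hτ₁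
  obtain ⟨ε₂, hε₂, hearly⟩ := exists_early_fraction hV hτ₁ ht₁
  refine ⟨N₀, min ε₁ ε₂, hN₀, lt_min hε₁ hε₂, ?_⟩
  intro t M ht hM htT hpin hMb hlock hgrad hheights hbudget
  have hL : 0 ≤ τ₁ * ν / M ^ 2 := by positivity
  rcases le_total t₁ t with h1 | h2
  · exact fraction_mono u (Set.Icc t (t + τ₁ * ν / M ^ 2)) (min_le_left _ _) hL
      (hlate t M ht hM htT hpin h1 hMb hlock hgrad hheights hbudget)
  · exact fraction_mono u (Set.Icc t (t + τ₁ * ν / M ^ 2)) (min_le_right _ _) hL (hearly t M ht hM htT hpin h2)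

end Summit.NavierStokesRegularity.NavierStokesRegularity.Theorems.NearExtremalTransiencePerFlow.PinnedDepletion

end
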